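import Summits.ResolutionOfSingularities.ResolutionOfSingularities.Theorems.FrobeniusLadderFInjectiveMacaulayficationTauFloorOneZChart
import Summits.ResolutionOfSingularities.ResolutionOfSingularities.Theorems.FrobeniusLadderFInjectiveMacaulayficationTauFloorOneChartXTransport
import Summits.ResolutionOfSingularities.ResolutionOfSingularities.Theorems.FrobeniusLadderFInjectiveMacaulayficationTauFloorOneChartYTransport
import Summits.ResolutionOfSingularities.ResolutionOfSingularities.Theorems.FrobeniusLadderFInjectiveMacaulayficationTauFloorOneChartSymmetry
import Summits.ResolutionOfSingularities.ResolutionOfSingularities.Theorems.FrobeniusLadderFInjectiveMacaulayficationStalkChartIso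
import Literature.AlgebraicGeometry.Resolution.BlowupsFlatBaseChange
import Literature.AlgebraicGeometry.Resolution.AffineBlowupUnique
import Literature.AlgebraicGeometry.Resolution.BlowupsScaling
import HarnessLib

/-!
# F4POS-1 (d): THE τ-FLOOR `S′ = Bl_τ X → Spec 𝒪_{X,v}` IS A LEGAL INPUT OF THE F-HALF
# (crux `FInjectiveMacaulayfication` stmt-ResolutionOfSingularities-15315, chain w45a; res-L1-w45a-plan-1 R18.17 (b)/R18.18 «F4POS-1 (d) → stub-1 g10, shape GO»;
# seat res-L1-w45a-stub-1 g10)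

[OURS · L1 W4.5a] Support file (`--supports stmt-ResolutionOfSingularities-15315 --as helper`); replaces the role of NO printed item; NOT a statement of any
manuscript; def-free; UNCONDITIONAL (§1–§3), §4 is the literal instantiation of the CANDIDATE statement `LocalFInjectivizationFibreAdmGe4` (taken as a
hypothesis, nothing asserted about it). AI-written (AI review is weaker than expert review).

WHAT. `X = Spec A₀`, `A₀ = k[X0..X4]/(f)`, `f = X4² + X0⁴X4 + X1³ + X2³ + X3³`, `char k = 2` (any field), `v` = the vertex, `τ = (x̄0², x̄1, x̄2, x̄3, x̄4)`
(res-L1-w45a-plan-1's test-ideal centre, TAU-PROBE), `ι = Spec 𝒪_{X,v} → X`, `I := τ̃|_{Spec 𝒪_{X,v}} = (affineBlowup.idealSheaf τ).comap ι`. For EVERY blowing up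
`g : S′ → Spec 𝒪_{X,v}` along `I` — the τ-floor in the F-half's input currency — the four `S′`-side binders of
`LocalFullificationFibreAdmGe4Split.LocalFInjectivizationFibreAdmGe4` hold:
* §4 ★★ `tauFloor_input_legal` (from the GENERIC §3 `offFibre_regular_and_cmCl` / `support_comap_subset_compl_regularLocus`, valid for any global blowing up
  `B → X` CM everywhere along a centre cosupported at an isolated singular point `x`): (1) `I ≠ ⊥`; (2) ADMISSIBLE: `Supp I ⊆ (Reg Spec 𝒪_{X,v})ᶜ` (indeed `Supp I = {closed point}`, `τ` being `𝔪_v`-primary, and the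
  vertex is singular); (3) `S′` is REGULAR OFF THE CLOSED FIBRE (`S′ ≅ Bl_τ X ×_X Spec 𝒪_{X,v}` by uniqueness of blowing ups and flat base change; stalks of the
  pro-open pro-subscheme are stalks of `Bl_τ X`; `Bl_τ X → X` is an isomorphism off `V(τ) = {v}`; `X` is regular off `v`); (4) `S′` is COHEN–MACAULAY at every point:
  every stalk of `Bl_τ X` is a local ring of one of the five Rees charts `D₊(x̄0²t), D₊(x̄1t), …, D₊(x̄4t)` (`StalkChartIso.stub_stalkChartIso`), and those are CM at
  every prime: `D(ȳ)` p622179 (`TauFloorOneChartYTransport`, the codim-2 complete intersection `C`), `D(ū), D(t̄)` p622567 (`TauFloorOneChartSymmetry`),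
  `D(x̄²)` res-L1-w45a-stub-2's `TauFloorOneChartXTransport` (hypersurface `C′`), `D(z̄)` p623460 (`TauFloorOneZChart`: the chart ring is all of `A₀[1/z̄]`) —
  §2 `cmCl_stalk_affineBlowup_tau`, via the generic §1 `cmCl_stalk_affineBlowup_of_charts`.
* §5 `fHalf_at_tauFloor`: HENCE the candidate F-half `LocalFInjectivizationFibreAdmGe4`, if true, APPLIES at `(d, p, X, x, S′, g, I) = (4, 2, X, v, S′, g, I)` — the binders
  match literally (X-side: `FCentreE1RungZero`).
Together with res-L1-w45a-stub-2's p615290 (`S′` is NOT FULL along a 3-fold) this is the input legality of the first F(4)-pos row (census: res-L1-w45a-tri-2).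
[folklore assembly; cite: StacksProject, Tag 0804; Tag 02OS; Tag 01J7] [cite: GortzWedhorn2020, Prop. 13.91 (2), (13.19)] [cite: Temkin2008, §2.1]
-/

-- single-problem summit: the doubled namespace component is forced
set_option linter.dupNamespace false

noncomputable section

namespace Summit.ResolutionOfSingularities.ResolutionOfSingularities.Theorems.FInjectiveMacaulayfication.TauFloorInputLegal

open CategoryTheory CategoryTheory.Limits AlgebraicGeometry TopologicalSpace IsLocalRing MvPolynomial
open Literature.AlgebraicGeometry.Resolution
open Summit.ResolutionOfSingularities.ResolutionOfSingularities.Theorems.FInjectiveMacaulayfication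
open SliceableCentre GermOfGlobalBlowup

/-! ## §1 Generic: CM stalks of an affine blowing up from CM charts -/

/-- **CM at every stalk of `Bl_I(Spec R)`, `I = (x₁,…,x_r)`, from CM at every prime of every Rees chart `(R[It])_{(xᵢt)}` of a non-zero generator**
(`StalkChartIso.stub_stalkChartIso`: every stalk is such a local ring). [folklore; cite: StacksProject, Tag 0804] -/
theorem cmCl_stalk_affineBlowup_of_charts {R : Type} [CommRing R] {r : ℕ} (x : Fin r → R)
    (hCM : ∀ i : Fin r, x i ≠ 0 → ∀ (q : Ideal (HomogeneousLocalization.Away (reesGrading (Ideal.span (Set.range x)))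
      (reesT (x i) (Ideal.subset_span (Set.mem_range_self i))))) [q.IsPrime], CMCl (Localization.AtPrime q))
    (y : ↥(affineBlowup (Ideal.span (Set.range x)))) : CMCl ((affineBlowup (Ideal.span (Set.range x))).presheaf.stalk y) := by
  obtain ⟨i, q, hxi, ⟨e⟩⟩ := StalkChartIso.stub_stalkChartIso R r x y
  exact FiLocusOpenOfAffine.cmClause_of_ringEquiv e.symm (hCM i hxi q.asIdeal)

/-! ## §2 `Bl_τ X` is Cohen–Macaulay at every point -/

/-- The five Rees charts of `Bl_τ X` at the generators `a ∈ {x̄0², x̄1, x̄2, x̄3, x̄4}` are CM at every prime (res-L1-w45a-stub-2's `TauFloorOneChartXTransport`, p622179,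
p622567, p623460, glued by `ReesChartFacts`). [folklore assembly] -/
theorem cmCl_reesChart_tau (k : Type) [Field k] [CharP k 2] (f : MvPolynomial (Fin 5) k) (hf : f = X 4 ^ 2 + X 0 ^ 4 * X 4 + X 1 ^ 3 + X 2 ^ 3 + X 3 ^ 3)
    (a : MvPolynomial (Fin 5) k ⧸ Ideal.span {f})
    (ha : a ∈ (Ideal.span {Ideal.Quotient.mk (Ideal.span {f}) (X 0) ^ 2, Ideal.Quotient.mk (Ideal.span {f}) (X 1),
        Ideal.Quotient.mk (Ideal.span {f}) (X 2), Ideal.Quotient.mk (Ideal.span {f}) (X 3), Ideal.Quotient.mk (Ideal.span {f}) (X 4)} :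
          Ideal (MvPolynomial (Fin 5) k ⧸ Ideal.span {f})))
    (h : a = Ideal.Quotient.mk (Ideal.span {f}) (X 0) ^ 2 ∨ a = Ideal.Quotient.mk (Ideal.span {f}) (X 1) ∨ a = Ideal.Quotient.mk (Ideal.span {f}) (X 2) ∨
      a = Ideal.Quotient.mk (Ideal.span {f}) (X 3) ∨ a = Ideal.Quotient.mk (Ideal.span {f}) (X 4))
    (q : Ideal (HomogeneousLocalization.Away (reesGrading (Ideal.span {Ideal.Quotient.mk (Ideal.span {f}) (X 0) ^ 2,
      Ideal.Quotient.mk (Ideal.span {f}) (X 1), Ideal.Quotient.mk (Ideal.span {f}) (X 2), Ideal.Quotient.mk (Ideal.span {f}) (X 3),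
      Ideal.Quotient.mk (Ideal.span {f}) (X 4)} : Ideal (MvPolynomial (Fin 5) k ⧸ Ideal.span {f}))) (reesT a ha))) [q.IsPrime] :
    CMCl (Localization.AtPrime q) := by
  rcases h with rfl | rfl | rfl | rfl | rfl
  · exact ReesChartFacts.reesChart_cmCl_of_blowupAlgebra_cmCl _ _ ha (fun Q _ => TauFloorOneChartXTransport.cmCl_localization_blowupAlgebra k f hf Q) q
  · exact ReesChartFacts.reesChart_cmCl_of_blowupAlgebra_cmCl _ _ ha (fun Q _ => TauFloorOneChartYTransport.cmCl_localization_blowupAlgebra k f hf Q) q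
  · exact ReesChartFacts.reesChart_cmCl_of_blowupAlgebra_cmCl _ _ ha (fun Q _ => (TauFloorOneChartSymmetry.chart_facts_of_swap k f hf 2 (Or.inl rfl)).1 Q) q
  · exact ReesChartFacts.reesChart_cmCl_of_blowupAlgebra_cmCl _ _ ha (fun Q _ => (TauFloorOneChartSymmetry.chart_facts_of_swap k f hf 3 (Or.inr rfl)).1 Q) q
  · exact TauFloorOneZChart.cmCl_localization_reesChart_z k f hf ha q

/-- The generator vector presents `τ`. [plumbing] -/
theorem span_range_eq_tau (k : Type) [Field k] (f : MvPolynomial (Fin 5) k) :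
    Ideal.span (Set.range ![Ideal.Quotient.mk (Ideal.span {f}) (X 0) ^ 2, Ideal.Quotient.mk (Ideal.span {f}) (X 1), Ideal.Quotient.mk (Ideal.span {f}) (X 2),
        Ideal.Quotient.mk (Ideal.span {f}) (X 3), Ideal.Quotient.mk (Ideal.span {f}) (X 4)]) =
      (Ideal.span {Ideal.Quotient.mk (Ideal.span {f}) (X 0) ^ 2, Ideal.Quotient.mk (Ideal.span {f}) (X 1),
        Ideal.Quotient.mk (Ideal.span {f}) (X 2), Ideal.Quotient.mk (Ideal.span {f}) (X 3), Ideal.Quotient.mk (Ideal.span {f}) (X 4)} :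
          Ideal (MvPolynomial (Fin 5) k ⧸ Ideal.span {f})) := by
  simp only [Matrix.range_cons, Matrix.range_empty, Set.union_empty, Set.singleton_union]

/-- ★ **`Bl_τ X = affineBlowup τ` satisfies the CM clause at EVERY point.** [folklore assembly; cite: StacksProject, Tag 0804] -/
theorem cmCl_stalk_affineBlowup_tau (k : Type) [Field k] [CharP k 2] (f : MvPolynomial (Fin 5) k) (hf : f = X 4 ^ 2 + X 0 ^ 4 * X 4 + X 1 ^ 3 + X 2 ^ 3 + X 3 ^ 3)
    (y : ↥(affineBlowup (Ideal.span {Ideal.Quotient.mk (Ideal.span {f}) (X 0) ^ 2, Ideal.Quotient.mk (Ideal.span {f}) (X 1),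
        Ideal.Quotient.mk (Ideal.span {f}) (X 2), Ideal.Quotient.mk (Ideal.span {f}) (X 3), Ideal.Quotient.mk (Ideal.span {f}) (X 4)} :
          Ideal (MvPolynomial (Fin 5) k ⧸ Ideal.span {f})))) :
    CMCl ((affineBlowup (Ideal.span {Ideal.Quotient.mk (Ideal.span {f}) (X 0) ^ 2, Ideal.Quotient.mk (Ideal.span {f}) (X 1),
        Ideal.Quotient.mk (Ideal.span {f}) (X 2), Ideal.Quotient.mk (Ideal.span {f}) (X 3), Ideal.Quotient.mk (Ideal.span {f}) (X 4)} :
          Ideal (MvPolynomial (Fin 5) k ⧸ Ideal.span {f}))).presheaf.stalk y) := by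
  -- chart facts for ANY ideal `J = τ`, in the `Set.range` presentation `StalkChartIso` wants
  have key : ∀ (J : Ideal (MvPolynomial (Fin 5) k ⧸ Ideal.span {f})),
      J = Ideal.span {Ideal.Quotient.mk (Ideal.span {f}) (X 0) ^ 2, Ideal.Quotient.mk (Ideal.span {f}) (X 1),
        Ideal.Quotient.mk (Ideal.span {f}) (X 2), Ideal.Quotient.mk (Ideal.span {f}) (X 3), Ideal.Quotient.mk (Ideal.span {f}) (X 4)} →
      ∀ (i : Fin 5) (hi : (![Ideal.Quotient.mk (Ideal.span {f}) (X 0) ^ 2, Ideal.Quotient.mk (Ideal.span {f}) (X 1), Ideal.Quotient.mk (Ideal.span {f}) (X 2),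
        Ideal.Quotient.mk (Ideal.span {f}) (X 3), Ideal.Quotient.mk (Ideal.span {f}) (X 4)] i) ∈ J)
        (q : Ideal (HomogeneousLocalization.Away (reesGrading J) (reesT _ hi))) [q.IsPrime], CMCl (Localization.AtPrime q) := by
    rintro J rfl i hi q _
    refine cmCl_reesChart_tau k f hf _ hi ?_ q
    fin_cases i
    exacts [Or.inl rfl, Or.inr (Or.inl rfl), Or.inr (Or.inr (Or.inl rfl)), Or.inr (Or.inr (Or.inr (Or.inl rfl))), Or.inr (Or.inr (Or.inr (Or.inr rfl)))]
  have h := cmCl_stalk_affineBlowup_of_charts _ (fun i _ q _ => key _ (span_range_eq_tau k f) i _ q)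
  rw [span_range_eq_tau k f] at h
  exact h y

/-! ## §3 Generic: the `S′`-side binders of the F-half for a local blowing up induced from a global one -/

/-- **ADMISSIBILITY of the induced local centre**: if `Supp J` meets the generizations of `x` only in `x` and `x` is a singular point, then
`Supp (J|_{Spec 𝒪_{X,x}}) ⊆ (Reg Spec 𝒪_{X,x})ᶜ` (the support is the closed point, whose local ring is `𝒪_{X,x}`). [folklore; cite: Temkin2008, §2.1] -/
theorem support_comap_subset_compl_regularLocus {X : Scheme.{0}} (x : X) (J : X.IdealSheafData)
    (hsupp : ∀ y ∈ (J.support : Set X), y ⤳ x → y = x) (hx : x ∉ Scheme.regularLocus X) :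
    ((J.comap (X.fromSpecStalk x)).support : Set (Spec (X.presheaf.stalk x))) ⊆ (Scheme.regularLocus (Spec (X.presheaf.stalk x)))ᶜ := by
  intro s hs hreg
  have hs' := support_comap_fromSpecStalk_subset_closedPoint J x hsupp s hs
  rw [AdmissibleLocalCentre.mem_regularLocus_Spec_stalk_iff, hs', Scheme.fromSpecStalk_closedPoint] at hreg
  exact hx hreg

/-- ★ **REGULAR OFF THE CLOSED FIBRE and CM EVERYWHERE, for every local blowing up `g : S′ → Spec 𝒪_{X,x}` along `J|_{Spec 𝒪_{X,x}}`**, given a global blowing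
up `π_B : B → X` along `J` with `B` CM at every point, `X` regular at the proper generizations of `x`, and `Supp J ∋ y ⤳ x ⇒ y = x`: `S′ ≅ B ×_X Spec 𝒪_{X,x}`
(uniqueness of blowing ups, flat base change GW 13.91 (2)), whose stalks are stalks of `B` (pro-open pro-subscheme, Temkin §2.1) at points over generizations of
`x`; off `x` the blowing up `π_B` is a local isomorphism (Stacks 02OS). [folklore assembly; cite: GortzWedhorn2020, Prop. 13.91 (2), (13.19)] [cite: StacksProject, Tag 02OS]
[cite: Temkin2008, §2.1] -/
theorem offFibre_regular_and_cmCl {X B : Scheme.{0}} (x : X) {πB : B ⟶ X} {J : X.IdealSheafData} (hB : IsBlowup πB J)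
    (hsupp : ∀ y ∈ (J.support : Set X), y ⤳ x → y = x)
    (hreg : ∀ y : X, y ⤳ x → y ≠ x → y ∈ Scheme.regularLocus X)
    (hcm : ∀ b : B, CMCl (B.presheaf.stalk b))
    {S' : Scheme.{0}} {g : S' ⟶ Spec (X.presheaf.stalk x)} (hg : IsBlowup g (J.comap (X.fromSpecStalk x))) :
    (∀ s : S', g.base s ≠ closedPoint (X.presheaf.stalk x) → s ∈ Scheme.regularLocus S') ∧ (∀ s : S', CMCl (S'.presheaf.stalk s)) := by
  haveI : Flat (X.fromSpecStalk x) := flat_fromSpecStalk X x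
  have hP := hB.pullback_snd_of_flat (X.fromSpecStalk x)
  obtain ⟨e, he, -⟩ := hg.unique hP
  -- stalks of `S′` are stalks of `B`
  have hstalk : ∀ s : S', Nonempty (B.presheaf.stalk ((pullback.fst πB (X.fromSpecStalk x)).base (e.hom.base s)) ≃+* S'.presheaf.stalk s) := by
    intro s
    haveI := isIso_stalkMap_of_flat_of_isPreimmersion e.hom s
    haveI := isIso_stalkMap_pullback_fst_fromSpecStalk πB x (e.hom.base s)
    exact ⟨(asIso ((pullback.fst πB (X.fromSpecStalk x)).stalkMap (e.hom.base s))).commRingCatIsoToRingEquiv.trans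
      (asIso (e.hom.stalkMap s)).commRingCatIsoToRingEquiv⟩
  refine ⟨fun s hs => ?_, fun s => ?_⟩
  · -- the point `b` of `B` under `s` lies over a PROPER generization of `x`
    have hgs : g.base s = (pullback.snd πB (X.fromSpecStalk x)).base (e.hom.base s) := by
      rw [← he]; rfl
    have hcond : πB.base ((pullback.fst πB (X.fromSpecStalk x)).base (e.hom.base s)) =
        (X.fromSpecStalk x).base ((pullback.snd πB (X.fromSpecStalk x)).base (e.hom.base s)) :=
      congrArg (fun φ => φ.base (e.hom.base s)) (pullback.condition (f := πB) (g := X.fromSpecStalk x))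
    have hspec : πB.base ((pullback.fst πB (X.fromSpecStalk x)).base (e.hom.base s)) ⤳ x := by
      rw [hcond]; exact fromSpecStalk_specializes x _
    have hne : πB.base ((pullback.fst πB (X.fromSpecStalk x)).base (e.hom.base s)) ≠ x := by
      intro h
      rw [hcond] at h
      exact hs (hgs.trans (eq_closedPoint_of_fromSpecStalk_eq x _ h))
    -- there `π_B` is a local isomorphism and `X` is regular
    have hU : πB.base ((pullback.fst πB (X.fromSpecStalk x)).base (e.hom.base s)) ∈
        (⟨(J.support : Set X)ᶜ, J.support.isClosed.isOpen_compl⟩ : X.Opens) := fun hmem => hne (hsupp _ hmem hspec)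
    haveI := hB.isIso_compl
    have hb : (pullback.fst πB (X.fromSpecStalk x)).base (e.hom.base s) ∈ Scheme.regularLocus B :=
      (mem_regularLocus_iff_of_isIso_morphismRestrict πB _ _ hU).mpr (hreg _ hspec hne)
    rw [Scheme.mem_regularLocus] at hb ⊢
    obtain ⟨es⟩ := hstalk s
    exact IsRegularLocalRing.of_ringEquiv es
  · obtain ⟨es⟩ := hstalk s
    exact FiLocusOpenOfAffine.cmClause_of_ringEquiv es (hcm _)

/-! ## §4 The four `S′`-side binders of the F-half at the τ-floor -/

/-- ★★ **F4POS-1 (d): the τ-floor is a LEGAL INPUT of the F-half.** For every blowing up `g : S′ → Spec 𝒪_{X,v}` along `I = τ̃|_{Spec 𝒪_{X,v}}`: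
(1) `I ≠ ⊥`; (2) `Supp I ⊆ (Reg Spec 𝒪_{X,v})ᶜ`; (3) `S′` is regular off the closed fibre; (4) `S′` satisfies the CM clause at every point. See the module docstring.
[folklore assembly; cite: GortzWedhorn2020, Prop. 13.91 (2), (13.19)] [cite: StacksProject, Tag 02OS; Tag 01J7] [cite: Temkin2008, §2.1] -/
theorem tauFloor_input_legal (k : Type) [Field k] [CharP k 2] (f : MvPolynomial (Fin 5) k)
    (hf : f = X 4 ^ 2 + X 0 ^ 4 * X 4 + X 1 ^ 3 + X 2 ^ 3 + X 3 ^ 3)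
    (v : Spec (.of (MvPolynomial (Fin 5) k ⧸ Ideal.span {f})))
    (hv : v.asIdeal = Ideal.span (Set.range fun j : Fin 5 => Ideal.Quotient.mk (Ideal.span {f}) (X j)))
    (S' : Scheme.{0}) (g : S' ⟶ Spec ((Spec (.of (MvPolynomial (Fin 5) k ⧸ Ideal.span {f}))).presheaf.stalk v))
    (hg : IsBlowup g ((affineBlowup.idealSheaf
        (Ideal.span {Ideal.Quotient.mk (Ideal.span {f}) (X 0) ^ 2, Ideal.Quotient.mk (Ideal.span {f}) (X 1),
          Ideal.Quotient.mk (Ideal.span {f}) (X 2), Ideal.Quotient.mk (Ideal.span {f}) (X 3), Ideal.Quotient.mk (Ideal.span {f}) (X 4)})).comap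
        ((Spec (.of (MvPolynomial (Fin 5) k ⧸ Ideal.span {f}))).fromSpecStalk v))) :
    (affineBlowup.idealSheaf
        (Ideal.span {Ideal.Quotient.mk (Ideal.span {f}) (X 0) ^ 2, Ideal.Quotient.mk (Ideal.span {f}) (X 1),
          Ideal.Quotient.mk (Ideal.span {f}) (X 2), Ideal.Quotient.mk (Ideal.span {f}) (X 3), Ideal.Quotient.mk (Ideal.span {f}) (X 4)})).comap
        ((Spec (.of (MvPolynomial (Fin 5) k ⧸ Ideal.span {f}))).fromSpecStalk v) ≠ ⊥ ∧
    ((((affineBlowup.idealSheaf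
        (Ideal.span {Ideal.Quotient.mk (Ideal.span {f}) (X 0) ^ 2, Ideal.Quotient.mk (Ideal.span {f}) (X 1),
          Ideal.Quotient.mk (Ideal.span {f}) (X 2), Ideal.Quotient.mk (Ideal.span {f}) (X 3), Ideal.Quotient.mk (Ideal.span {f}) (X 4)})).comap
        ((Spec (.of (MvPolynomial (Fin 5) k ⧸ Ideal.span {f}))).fromSpecStalk v)).support :
          Set (Spec ((Spec (.of (MvPolynomial (Fin 5) k ⧸ Ideal.span {f}))).presheaf.stalk v))) ⊆
      (Scheme.regularLocus (Spec ((Spec (.of (MvPolynomial (Fin 5) k ⧸ Ideal.span {f}))).presheaf.stalk v)))ᶜ) ∧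
    (∀ s : S', g.base s ≠ closedPoint ((Spec (.of (MvPolynomial (Fin 5) k ⧸ Ideal.span {f}))).presheaf.stalk v) → s ∈ Scheme.regularLocus S') ∧
    (∀ s : S', CMCl (S'.presheaf.stalk s)) := by
  classical
  haveI := FCentreE1RungZero.isIntegral_p2d4c k f hf
  -- `τ ≠ ⊥` (it contains `x̄1 ≠ 0`)
  have hτ0 : (Ideal.span {Ideal.Quotient.mk (Ideal.span {f}) (X 0) ^ 2, Ideal.Quotient.mk (Ideal.span {f}) (X 1),
      Ideal.Quotient.mk (Ideal.span {f}) (X 2), Ideal.Quotient.mk (Ideal.span {f}) (X 3), Ideal.Quotient.mk (Ideal.span {f}) (X 4)} :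
        Ideal (MvPolynomial (Fin 5) k ⧸ Ideal.span {f})) ≠ ⊥ := by
    intro h0
    have hmem : Ideal.Quotient.mk (Ideal.span {f}) (X 1 : MvPolynomial (Fin 5) k) ∈
        Ideal.span {Ideal.Quotient.mk (Ideal.span {f}) (X 0) ^ 2, Ideal.Quotient.mk (Ideal.span {f}) (X 1),
          Ideal.Quotient.mk (Ideal.span {f}) (X 2), Ideal.Quotient.mk (Ideal.span {f}) (X 3), Ideal.Quotient.mk (Ideal.span {f}) (X 4)} :=
      Ideal.subset_span (by simp)
    rw [h0, Ideal.mem_bot] at hmem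
    exact (FCentreE1ChartPresentation.mk_X_ne_zero k f hf).2 hmem
  -- the support `V(τ)` of `τ̃` meets the generizations of `v` only in `v`: a prime containing `τ` contains every `x̄j`
  have hsupp : ∀ y ∈ ((affineBlowup.idealSheaf
      (Ideal.span {Ideal.Quotient.mk (Ideal.span {f}) (X 0) ^ 2, Ideal.Quotient.mk (Ideal.span {f}) (X 1),
        Ideal.Quotient.mk (Ideal.span {f}) (X 2), Ideal.Quotient.mk (Ideal.span {f}) (X 3), Ideal.Quotient.mk (Ideal.span {f}) (X 4)} :
          Ideal (MvPolynomial (Fin 5) k ⧸ Ideal.span {f}))).support : Set (Spec (.of (MvPolynomial (Fin 5) k ⧸ Ideal.span {f})))), y ⤳ v → y = v := by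
    intro y hy hyv
    rw [affineBlowup.support_idealSheaf] at hy
    have hτy : (Ideal.span {Ideal.Quotient.mk (Ideal.span {f}) (X 0) ^ 2, Ideal.Quotient.mk (Ideal.span {f}) (X 1),
        Ideal.Quotient.mk (Ideal.span {f}) (X 2), Ideal.Quotient.mk (Ideal.span {f}) (X 3), Ideal.Quotient.mk (Ideal.span {f}) (X 4)} :
          Ideal (MvPolynomial (Fin 5) k ⧸ Ideal.span {f})) ≤ y.asIdeal := fun a ha => hy ha
    have h1 : v.asIdeal ≤ y.asIdeal := by
      rw [hv, Ideal.span_le]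
      rintro _ ⟨j, rfl⟩
      have hx0 : Ideal.Quotient.mk (Ideal.span {f}) (X 0) ∈ y.asIdeal :=
        y.2.mem_of_pow_mem 2 (hτy (Ideal.subset_span (by simp)))
      fin_cases j
      · exact hx0
      · exact hτy (Ideal.subset_span (by simp))
      · exact hτy (Ideal.subset_span (by simp))
      · exact hτy (Ideal.subset_span (by simp))
      · exact hτy (Ideal.subset_span (by simp))
    have h2 : y.asIdeal ≤ v.asIdeal := (PrimeSpectrum.le_iff_specializes y v).mpr hyv
    exact PrimeSpectrum.ext (le_antisymm h2 h1)
  have h34 := offFibre_regular_and_cmCl v (affineBlowup.isBlowup _) hsupp (FCentreE1RungZero.regular_of_ne_vertex k f hf v hv)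
    (cmCl_stalk_affineBlowup_tau k f hf) hg
  exact ⟨comap_fromSpecStalk_ne_bot (affineBlowup.idealSheaf_ne_bot hτ0) v,
    support_comap_subset_compl_regularLocus v _ hsupp (FCentreE1RungZero.vertex_not_mem_regularLocus k f hf v hv), h34.1, h34.2⟩

/-! ## §5 Hence the candidate F-half applies at the τ-floor -/

/-- **The candidate F-half `LocalFInjectivizationFibreAdmGe4` (taken as a hypothesis), instantiated at the τ-floor**: the binders match literally
(X-side: `FCentreE1RungZero`; S′-side: `tauFloor_input_legal`). [OURS · instantiation of a candidate statement] -/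
theorem fHalf_at_tauFloor (h : LocalFullificationFibreAdmGe4Split.LocalFInjectivizationFibreAdmGe4) (k : Type) [Field k] [CharP k 2]
    (f : MvPolynomial (Fin 5) k) (hf : f = X 4 ^ 2 + X 0 ^ 4 * X 4 + X 1 ^ 3 + X 2 ^ 3 + X 3 ^ 3)
    (v : Spec (.of (MvPolynomial (Fin 5) k ⧸ Ideal.span {f})))
    (hv : v.asIdeal = Ideal.span (Set.range fun j : Fin 5 => Ideal.Quotient.mk (Ideal.span {f}) (X j)))
    (S' : Scheme.{0}) (g : S' ⟶ Spec ((Spec (.of (MvPolynomial (Fin 5) k ⧸ Ideal.span {f}))).presheaf.stalk v))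
    (hg : IsBlowup g ((affineBlowup.idealSheaf
        (Ideal.span {Ideal.Quotient.mk (Ideal.span {f}) (X 0) ^ 2, Ideal.Quotient.mk (Ideal.span {f}) (X 1),
          Ideal.Quotient.mk (Ideal.span {f}) (X 2), Ideal.Quotient.mk (Ideal.span {f}) (X 3), Ideal.Quotient.mk (Ideal.span {f}) (X 4)})).comap
        ((Spec (.of (MvPolynomial (Fin 5) k ⧸ Ideal.span {f}))).fromSpecStalk v))) :
    ∃ 𝓚 : S'.IdealSheafData, 𝓚 ≠ ⊥ ∧
      (∀ s ∈ (𝓚.support : Set S'), g.base s = closedPoint ((Spec (.of (MvPolynomial (Fin 5) k ⧸ Ideal.span {f}))).presheaf.stalk v)) ∧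
      ∀ (S'' : Scheme.{0}) (π : S'' ⟶ S'), IsBlowup π 𝓚 → ∀ s : S'', FullCl 2 (S''.presheaf.stalk s) := by
  haveI := FCentreE1RungZero.isIntegral_p2d4c k f hf
  obtain ⟨h1, h2, h3, h4⟩ := tauFloor_input_legal k f hf v hv S' g hg
  exact h 4 le_rfl 2 Nat.prime_two k (Spec (.of (MvPolynomial (Fin 5) k ⧸ Ideal.span {f})))
    (Spec.map (CommRingCat.ofHom (algebraMap k (MvPolynomial (Fin 5) k ⧸ Ideal.span {f}))))
    (FermatCubicConeGerm.structureMorphism_isSeparated k f) (FermatCubicConeGerm.structureMorphism_locallyOfFiniteType k f)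
    (FermatCubicConeGerm.structureMorphism_quasiCompact k f) inferInstance v (FCentreE1RungZero.isClosed_vertex k f hf v hv)
    (FCentreE1RungZero.vertex_not_mem_regularLocus k f hf v hv) (FCentreE1RungZero.ringKrullDim_stalk_vertex k f hf v hv) S' g _ h1 h2 hg h3 h4

end Summit.ResolutionOfSingularities.ResolutionOfSingularities.Theorems.FInjectiveMacaulayfication.TauFloorInputLegal

end
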